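/-
Origin: expansion seat `planner-pub-hodgecm-pv10-0`, handover #25 2026-08-18T06:08:01Z (`HOME/pub-hodgecm-pv10/lean/Pv10/ArchimedeanShells.lean`, md5 edf76a88, 114 lines);
landed by the gen-6 packager in gate run 24 as `HodgeCM/PerL34/ArchimedeanShells.lean` (import ^import Pv[0-9]+\.→import HodgeCM.PerL34. ×2).
-/
/-
# Compact boxes in `K_∞^×`

WIP module `Pv10.ArchimedeanShells` (pub-hodgecm-pv10); intended landing
`HodgeCM/PerL34/ArchimedeanShells.lean`.

Node N15, successor glue for the typed input `ArchShellCompactModPrincipal` (the unit-theorem half of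
the compactness of `C¹_K`, see `NormOneFromClassNumber`): the compact sets the unit theorem moves
every norm-`c` element of `K_∞^×` into are the boxes
`archBox K B = {a ∈ K_∞^× : ∀ w, e^{-B} ≤ ‖a_w‖ ≤ e^{B}}`.  This file proves they ARE compact
(KERNEL, Mathlib only): `K_w` is proper (`ProperSpace`), closed annuli in `K_w^×` are compact
(`Units.isEmbedding_val₀`), and `K_∞^× ≃ₜ* Π_w K_w^×` (`ContinuousMulEquiv.piUnits`).
What then remains of (UT) for a successor is the log-lattice step alone: Mathlib's
`NumberField.Units.unitLattice` is a full `ℤ`-lattice (`instIsZLattice`), so a bounded fundamental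
domain (`ZSpan.fundamentalDomain_isBounded`) gives `B` with
`∀ a, ‖a‖ = c → ∃ ε : (𝓞 K)ˣ, a * unitsToInfUnits K ε ∈ archBox K B'`; feed that to
`archShellCompactModPrincipal_of_units`.
-/
import Mathlib.Topology.Algebra.Group.Units
import Summits.HodgeConjecture.HodgeCM.PerL34.PolarDecomposition
import Summits.HodgeConjecture.HodgeCM.PerL34.NormOneFromClassNumber

/-! PORT of `HodgeCM/PerL34/ArchimedeanShells.lean` (HodgeCMPerL run 82) — verbatim mechanical port; provenance in the PORT header line. -/

set_option autoImplicit false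

noncomputable section

open Topology Filter Set Function

namespace NumberField

namespace InfinitePlace.Completion

variable {K : Type*} [Field K] (w : InfinitePlace K)

/-- The closed annulus `{z : r ≤ ‖z‖ ≤ R}` of `K_w` is compact (pulled back from `ℂ` along the
isometric closed embedding `K_w → ℂ`). -/
theorem isCompact_annulus (r R : ℝ) : IsCompact {z : w.Completion | r ≤ ‖z‖ ∧ ‖z‖ ≤ R} := by
  have hC : IsCompact {z : ℂ | r ≤ ‖z‖ ∧ ‖z‖ ≤ R} := by
    have h : {z : ℂ | r ≤ ‖z‖ ∧ ‖z‖ ≤ R} = Metric.closedBall 0 R ∩ (Metric.ball 0 r)ᶜ := by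
      ext z
      simp only [mem_setOf_eq, mem_inter_iff, mem_compl_iff, Metric.mem_closedBall, Metric.mem_ball,
        dist_zero_right, not_lt]
      exact and_comm
    rw [h]
    exact (isCompact_closedBall 0 R).inter_right Metric.isOpen_ball.isClosed_compl
  have hpre : {z : w.Completion | r ≤ ‖z‖ ∧ ‖z‖ ≤ R} =
      extensionEmbedding w ⁻¹' {z : ℂ | r ≤ ‖z‖ ∧ ‖z‖ ≤ R} := by
    ext z
    simp only [mem_setOf_eq, mem_preimage, InfiniteAdeleRing.norm_extensionEmbedding K w z]
  rw [hpre]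
  exact (isometry_extensionEmbedding w).isClosedEmbedding.isCompact_preimage hC

/-- The closed annulus `{u : r ≤ ‖u‖ ≤ R}` of `K_w^×` is compact when `0 < r` (units topology). -/
theorem isCompact_units_annulus {r : ℝ} (hr : 0 < r) (R : ℝ) :
    IsCompact {u : (w.Completion)ˣ | r ≤ ‖(u : w.Completion)‖ ∧ ‖(u : w.Completion)‖ ≤ R} := by
  refine Units.isEmbedding_val₀.isCompact_iff.mpr ?_
  convert isCompact_annulus w r R using 1
  ext z
  constructor
  · rintro ⟨u, hu, rfl⟩
    exact hu
  · intro hz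
    have hz0 : z ≠ 0 := by
      rintro rfl
      rw [mem_setOf_eq, norm_zero] at hz
      exact (not_le.mpr hr) hz.1
    exact ⟨Units.mk0 z hz0, hz, rfl⟩

end InfinitePlace.Completion

variable (K : Type*) [Field K]

/-- `K_∞^× ≃ₜ* Π_w K_w^×`. -/
def infUnitsPi : (InfiniteAdeleRing K)ˣ ≃ₜ* Π w : InfinitePlace K, (w.Completion)ˣ :=
  ContinuousMulEquiv.piUnits (M := fun w : InfinitePlace K => w.Completion)

/-- (Ported verbatim from the HodgeCMPerL package; no docstring in the source.) -/
theorem infUnitsPi_apply_coe (a : (InfiniteAdeleRing K)ˣ) (w : InfinitePlace K) :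
    ((infUnitsPi K a w : (w.Completion)ˣ) : w.Completion) = (a : InfiniteAdeleRing K) w := rfl

/-- The box `{a ∈ K_∞^× : ∀ w, e^{-B} ≤ ‖a_w‖ ≤ e^{B}}`. -/
def archBox (B : ℝ) : Set (InfiniteAdeleRing K)ˣ :=
  {a | ∀ w : InfinitePlace K, Real.exp (-B) ≤ ‖(a : InfiniteAdeleRing K) w‖ ∧
    ‖(a : InfiniteAdeleRing K) w‖ ≤ Real.exp B}

/-- (Ported verbatim from the HodgeCMPerL package; no docstring in the source.) -/
theorem archBox_eq_preimage (B : ℝ) :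
    archBox K B = infUnitsPi K ⁻¹' (univ.pi fun w : InfinitePlace K =>
      {u : (w.Completion)ˣ | Real.exp (-B) ≤ ‖(u : w.Completion)‖ ∧
        ‖(u : w.Completion)‖ ≤ Real.exp B}) := by
  ext a
  simp only [archBox, mem_setOf_eq, mem_preimage, mem_univ_pi]
  exact Iff.rfl

/-- **The boxes `archBox K B` are compact** (KERNEL). -/
theorem isCompact_archBox (B : ℝ) : IsCompact (archBox K B) := by
  rw [archBox_eq_preimage]
  exact (infUnitsPi K).toHomeomorph.isCompact_preimage.mpr
    (isCompact_univ_pi fun w =>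
      InfinitePlace.Completion.isCompact_units_annulus w (Real.exp_pos _) _)

variable [NumberField K]

/-- Hence the log-lattice form of the unit theorem suffices for (UT): if some `B` (depending on `c`)
works for every norm-`c` element up to a global unit, then `ArchShellCompactModPrincipal K`. -/
theorem archShellCompactModPrincipal_of_archBox
    (h : ∀ c : ℝ, 0 < c → ∃ B : ℝ, ∀ a : (InfiniteAdeleRing K)ˣ, ‖(a : InfiniteAdeleRing K)‖ = c →
      ∃ ε : (𝓞 K)ˣ, a * unitsToInfUnits K ε ∈ archBox K B) :
    ArchShellCompactModPrincipal K :=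
  archShellCompactModPrincipal_of_units K fun c hc => by
    obtain ⟨B, hB⟩ := h c hc
    exact ⟨archBox K B, isCompact_archBox K B, hB⟩

end NumberField

end
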